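/-
Copyright (c) 2026 the pub-hodgecm-mathlib formalisation cell (harness21).  Prover seat hodgecm-mathlib-F0P3a-p04 (g31): E1 row 47d glue (G4) «THE LOCAL MODEL OF A BLOCK IMAGE IN THE
COINVARIANTS AND THE (E)-BRIDGE» (joins ★ 47d-(α) `SchneiderStuhlerEPInducedTraceMackey`'s `finrank ↥Eig` to ★ 47c-4χ(b)'s `finrank ↥([W_r] ⊓ E)`; dealt by the E1 keeper
F0P3a-p03 (g30) 02:58:32Z ∕ 03:07:54Z «the bridge line is yours»), over ★ 47c FILE 2a∕2b (F0P3-p02) and ★ 47c-4χ(a) (LH5-p02), 2026-09-03.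
-/
import Literature.RepresentationTheory.CoinvariantsBlockPermutation   -- ★ 47c FILE 1∕2a: `coinvariants_mk_eq_zero_iff_mem_localKer`
import Literature.LinearAlgebra.EigenRestrictionGradedShift           -- ★ 47c-4χ(a): `apply_mem_eigen_of_mem_eigen`, `mem_eigen_of_apply_mem_eigen`
import HarnessLib

/-!
# The local model of a block image in the coinvariants of a block-permutation module, and the eigenspace bridge

Topic `RepresentationTheory` (sibling of ★ `CoinvariantsBlockPermutation`, ★ `CoinvariantsBlockPermutationGrading`); namespaces `Representation` (§1–§2, §4) and `LinearMap` (§3);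
THEOREMS ONLY (no definition, instance, notation or named fact).  Cell `pub/hodgecm-mathlib` (D-0151), crux H413 = `stmt-HodgeConjecture-24833`, lane `--supports`; E1 row 47d glue
(G4).  Count-neutral generic base layer; HC_CM is proved only modulo the 7 printed citations (2 remaining named inputs: hLiu418 = `stmt-HodgeConjecture-24832`, h413 =
`stmt-HodgeConjecture-24833`) until rung 0 closes.

SETTING (★ FILE 1's): `τ : Representation k N M`, blocks `Blk : β → Submodule k M` permuted along `act` (an internal direct sum), orbit representatives `R` with `rep`, `tr`.
For a representative `r ∈ R`, ★ FILE 2a computes the kernel of `W_r → M_N` as the LOCAL KERNEL `K_r = ⟨τ(s) w − w : s·r = r, w ∈ W_r⟩`.  A LOCAL MODEL of the block is an abstract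
copy `emb : E′ ↪ M` of `W_r` (`range emb = W_r`) with a representation `τ′` of the stabiliser `N_r = {s | s·r = r}` on `E′` compatible with `τ` (`hemb`), and a quotient `q : E′ ↠ Q` with
`ker q = Coinvariants.ker τ′` (so `Q ≅ (E′)_{N_r}`; at the Bruhat–Tits datum `E′ = V^{U_r}`, `N_r = N ∩ P_r`, `Q` the local Jacquet module of ★ 47d-(α)).
* §1 `exists_localModel_embedding`: there is an INJECTIVE `ψ : Q → M_N` with `ψ ∘ q = [·] ∘ emb` and `range ψ = [W_r]` (first isomorphism theorem + ★ FILE 2a).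
* §2 `comp_eq_comp_of_localModel`: `ψ` intertwines endomorphisms `T_Q` of `Q` and `T` of `M_N` that are induced from compatible endomorphisms upstairs (`q ∘ T_E = T_Q ∘ q`,
  `emb ∘ T_E = T_M ∘ emb`, `[·] ∘ T_M = T ∘ [·]`) — at the datum the compact torus `c ↦ ρ(c)`, which fixes `r`.
* §3 `LinearMap.map_eigen_eq_range_inf_eigen` ∕ `LinearMap.finrank_eigen_eq_finrank_range_inf_eigen`: along an equivariant injection the simultaneous eigenspace (★ 4χ(a)-style `hEig`)
  maps ONTO `range ψ ⊓ E`, so `dim Eig = dim (range ψ ⊓ E)`.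
* §4 **`finrank_eigen_localModel_eq`**: `dim Eig(Q) = dim ([W_r] ⊓ E)` — the (E)-BRIDGE between ★ 47d-(α)'s per-facet multiplicity `finrank ↥Eig` and ★ 47c-4χ(b)'s block term.

## References
* [Brown1982] K. S. Brown, *Cohomology of Groups*, GTM 87 (1982), III §5–§6 ((6.2): coinvariants of an induced∕permutation module).
* [BernsteinZelevinsky1976] I. N. Bernstein, A. V. Zelevinsky, *Representations of the group `GL(n,F)`*, Russian Math. Surveys 31 (1976), §2.3.
* [Casselman1995] W. Casselman, *Introduction to the theory of admissible representations of `p`-adic reductive groups* (1995 notes), §6.3.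
-/

set_option autoImplicit false

namespace Representation

open Function Module

section LocalModel

variable {k N M : Type*} [Field k] [Group N] [AddCommGroup M] [Module k M] {τ : Representation k N M}
variable {β : Type*} {Blk : β → Submodule k M} {act : N → β → β}
variable {E' Q : Type*} [AddCommGroup E'] [Module k E'] [AddCommGroup Q] [Module k Q]

/-! ## §1 The local model embeds into the coinvariants with image the block image -/

/-- The local kernel of ★ FILE 2a is the image of the coinvariant kernel of the local model: `⟨τ(s) w − w : s·r = r, w ∈ W_r⟩ = emb (Coinvariants.ker τ′)`.
[cite: Brown1982, III §6 (6.2)] -/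
theorem span_localKer_eq_map_coinvariantsKer {r : β} (emb : E' →ₗ[k] M) (hrange : LinearMap.range emb = Blk r)
    (Nr : Subgroup N) (hNr : ∀ s : N, s ∈ Nr ↔ act s r = r) (τ' : Representation k Nr E') (hemb : ∀ (s : Nr) (e : E'), emb (τ' s e) = τ (s : N) (emb e)) :
    Submodule.span k {x : M | ∃ (s : N) (w : M), act s r = r ∧ w ∈ Blk r ∧ x = τ s w - w} = (Coinvariants.ker τ').map emb := by
  apply le_antisymm
  · refine Submodule.span_le.2 ?_
    rintro _ ⟨s, w, hs, hw, rfl⟩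
    rw [← hrange] at hw
    obtain ⟨e, rfl⟩ := hw
    refine ⟨τ' ⟨s, (hNr s).2 hs⟩ e - e, Coinvariants.sub_mem_ker _ _, ?_⟩
    rw [map_sub, hemb]
  · rw [Submodule.map_le_iff_le_comap]
    refine Submodule.span_le.2 ?_
    rintro _ ⟨⟨s, e⟩, rfl⟩
    refine Submodule.subset_span ⟨(s : N), emb e, (hNr s).1 s.2, ?_, ?_⟩
    · rw [← hrange]; exact LinearMap.mem_range_self emb e
    · simp only [map_sub, hemb]

/-- **THE LOCAL MODEL EMBEDS**: for a representative `r ∈ R` and a local model `(emb, N_r, τ′, q)` of the block `W_r` there is an INJECTIVE linear map `ψ : Q → M_N` with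
`ψ (q e) = [emb e]` and `range ψ = [W_r]` (the kernel of `[·] ∘ emb` is `emb⁻¹ K_r = ker q` by ★ FILE 2a). [cite: Brown1982, III §6 (6.2)] [cite: Casselman1995, §6.3] -/
theorem exists_localModel_embedding [DecidableEq β] (h : DirectSum.IsInternal Blk) (hact : ∀ n n' b, act (n * n') b = act n (act n' b)) (hact1 : ∀ b, act 1 b = b)
    (hperm : ∀ n b m, m ∈ Blk b → τ n m ∈ Blk (act n b)) {R : Set β} (rep : β → β) (tr : β → N) (htr : ∀ b, act (tr b) (rep b) = b)
    (hrep_act : ∀ n b, rep (act n b) = rep b) (hrep_id : ∀ r ∈ R, rep r = r) {r : β} (hr : r ∈ R)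
    (emb : E' →ₗ[k] M) (hinj : Injective emb) (hrange : LinearMap.range emb = Blk r)
    (Nr : Subgroup N) (hNr : ∀ s : N, s ∈ Nr ↔ act s r = r) (τ' : Representation k Nr E') (hemb : ∀ (s : Nr) (e : E'), emb (τ' s e) = τ (s : N) (emb e))
    (q : E' →ₗ[k] Q) (hq : Surjective q) (hker : LinearMap.ker q = Coinvariants.ker τ') :
    ∃ ψ : Q →ₗ[k] Coinvariants τ, Injective ψ ∧ LinearMap.range ψ = (Blk r).map (Coinvariants.mk τ) ∧ ∀ e : E', ψ (q e) = Coinvariants.mk τ (emb e) := by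
  -- the kernel of `[·] ∘ emb` is `ker q`
  have hK : LinearMap.ker (Coinvariants.mk τ ∘ₗ emb) = LinearMap.ker q := by
    ext e
    rw [LinearMap.mem_ker, LinearMap.comp_apply, hker,
      coinvariants_mk_eq_zero_iff_mem_localKer h hact hact1 hperm rep tr htr hrep_act hrep_id hr (by rw [← hrange]; exact LinearMap.mem_range_self emb e),
      span_localKer_eq_map_coinvariantsKer emb hrange Nr hNr τ' hemb]
    constructor
    · rintro ⟨e', he', hee'⟩
      rw [← hinj hee']
      exact he'
    · exact fun he => ⟨e, he, rfl⟩
  refine ⟨(LinearMap.ker q).liftQ (Coinvariants.mk τ ∘ₗ emb) hK.symm.le ∘ₗ (q.quotKerEquivOfSurjective hq).symm.toLinearMap, ?_, ?_, fun e => ?_⟩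
  · rw [LinearMap.coe_comp]
    refine Injective.comp ?_ (q.quotKerEquivOfSurjective hq).symm.injective
    rw [← LinearMap.ker_eq_bot]
    exact Submodule.ker_liftQ_eq_bot _ _ _ hK.le
  · rw [LinearMap.range_comp, LinearEquiv.range, Submodule.map_top, Submodule.range_liftQ, LinearMap.range_comp, hrange]
  · rw [LinearMap.comp_apply, LinearEquiv.coe_toLinearMap, LinearMap.quotKerEquivOfSurjective_symm_apply, Submodule.liftQ_apply, LinearMap.comp_apply]

/-! ## §2 The embedding intertwines induced endomorphisms -/

omit [Group N] in
/-- **THE LOCAL EMBEDDING INTERTWINES INDUCED ENDOMORPHISMS**: if `ψ (q e) = mk (emb e)`, `q` is onto, and `T_E`, `T_Q`, `T_M`, `T` are compatible (`q ∘ T_E = T_Q ∘ q`,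
`emb ∘ T_E = T_M ∘ emb`, `mk ∘ T_M = T ∘ mk`), then `ψ ∘ T_Q = T ∘ ψ`. [cite: BernsteinZelevinsky1976, §2.3] -/
theorem comp_eq_comp_of_localModel {MN : Type*} [AddCommGroup MN] [Module k MN] (mk : M →ₗ[k] MN) (emb : E' →ₗ[k] M) (q : E' →ₗ[k] Q) (hq : Surjective q)
    (ψ : Q →ₗ[k] MN) (hψ : ∀ e : E', ψ (q e) = mk (emb e)) {TE : E' →ₗ[k] E'} {TQ : Q →ₗ[k] Q} {TM : M →ₗ[k] M} {T : MN →ₗ[k] MN}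
    (hqT : ∀ e, q (TE e) = TQ (q e)) (hembT : ∀ e, emb (TE e) = TM (emb e)) (hmkT : ∀ m, mk (TM m) = T (mk m)) : ψ ∘ₗ TQ = T ∘ₗ ψ := by
  refine LinearMap.ext fun x => ?_
  obtain ⟨e, rfl⟩ := hq x
  rw [LinearMap.comp_apply, LinearMap.comp_apply, ← hqT, hψ, hψ, hembT, hmkT]

end LocalModel

end Representation

/-! ## §3 Eigenspaces along an equivariant injection -/

namespace LinearMap

variable {k Q M' : Type*} [Field k] [AddCommGroup Q] [Module k Q] [AddCommGroup M'] [Module k M'] {ι : Type*}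
  {TQ : ι → Q →ₗ[k] Q} {TM : ι → M' →ₗ[k] M'} {χ : ι → k}

/-- **THE IMAGE OF THE EIGENSPACE ALONG AN EQUIVARIANT INJECTION IS THE EIGENSPACE OF THE IMAGE**: `ψ(Eig) = range ψ ⊓ E` for `ψ ∘ TQ i = TM i ∘ ψ`, `ψ` injective, `Eig`, `E` the
simultaneous `χ`-eigenspaces (★ 4χ(a) `apply_mem_eigen_of_mem_eigen` ∕ `mem_eigen_of_apply_mem_eigen`). [cite: BernsteinZelevinsky1976, §2.3] -/
theorem map_eigen_eq_range_inf_eigen {Eig : Submodule k Q} (hEig : ∀ v, v ∈ Eig ↔ ∀ i, TQ i v = χ i • v) {E : Submodule k M'} (hE : ∀ x, x ∈ E ↔ ∀ i, TM i x = χ i • x)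
    (ψ : Q →ₗ[k] M') (hψ : ∀ i, ψ ∘ₗ TQ i = TM i ∘ₗ ψ) (hinj : Function.Injective ψ) : Eig.map ψ = LinearMap.range ψ ⊓ E := by
  ext x
  constructor
  · rintro ⟨v, hv, rfl⟩
    exact ⟨LinearMap.mem_range_self ψ v, apply_mem_eigen_of_mem_eigen hEig hE hψ hv⟩
  · rintro ⟨⟨v, rfl⟩, hx⟩
    exact ⟨v, mem_eigen_of_apply_mem_eigen hEig hE hinj hψ hx, rfl⟩

/-- **`dim Eig = dim (range ψ ⊓ E)`** along an equivariant injection `ψ`. [cite: BernsteinZelevinsky1976, §2.3] -/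
theorem finrank_eigen_eq_finrank_range_inf_eigen {Eig : Submodule k Q} (hEig : ∀ v, v ∈ Eig ↔ ∀ i, TQ i v = χ i • v) {E : Submodule k M'}
    (hE : ∀ x, x ∈ E ↔ ∀ i, TM i x = χ i • x) (ψ : Q →ₗ[k] M') (hψ : ∀ i, ψ ∘ₗ TQ i = TM i ∘ₗ ψ) (hinj : Function.Injective ψ) :
    Module.finrank k Eig = Module.finrank k ↥(LinearMap.range ψ ⊓ E) := by
  rw [← map_eigen_eq_range_inf_eigen hEig hE ψ hψ hinj]
  exact LinearEquiv.finrank_eq (Submodule.equivMapOfInjective ψ hinj Eig)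

end LinearMap

/-! ## §4 The (E)-bridge: `dim Eig(Q) = dim ([W_r] ⊓ E)` -/

namespace Representation

open Function Module

variable {k N M : Type*} [Field k] [Group N] [AddCommGroup M] [Module k M] {τ : Representation k N M}
variable {β : Type*} {Blk : β → Submodule k M} {act : N → β → β}
variable {E' Q : Type*} [AddCommGroup E'] [Module k E'] [AddCommGroup Q] [Module k Q]

/-- **THE (E)-BRIDGE `dim Eig(Q) = dim ([W_r] ⊓ E)`**: for a representative `r ∈ R`, a local model `(emb, N_r, τ′, q : E′ ↠ Q)` of `W_r`, a family of endomorphisms `T_E i` of `E′`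
inducing `T_Q i` on `Q` and restricting endomorphisms `T_M i` of `M` that induce `T i` on `M_N`, and the simultaneous `χ`-eigenspaces `Eig ≤ Q` of `T_Q`, `E ≤ M_N` of `T`:
`finrank ↥Eig = finrank ↥([W_r] ⊓ E)`.  At the Bruhat–Tits datum: `Q = (V^{U_r})_{N ∩ P_r}` with the compact torus `T_c` (★ 47d-(α)'s `Eig`), `[W_r] ⊓ E` = ★ 47c-4χ(b)'s block term.
[cite: BernsteinZelevinsky1976, §2.3] [cite: Brown1982, III §6 (6.2)] [cite: Casselman1995, §6.3] -/
theorem finrank_eigen_localModel_eq [DecidableEq β] (h : DirectSum.IsInternal Blk) (hact : ∀ n n' b, act (n * n') b = act n (act n' b)) (hact1 : ∀ b, act 1 b = b)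
    (hperm : ∀ n b m, m ∈ Blk b → τ n m ∈ Blk (act n b)) {R : Set β} (rep : β → β) (tr : β → N) (htr : ∀ b, act (tr b) (rep b) = b)
    (hrep_act : ∀ n b, rep (act n b) = rep b) (hrep_id : ∀ r ∈ R, rep r = r) {r : β} (hr : r ∈ R)
    (emb : E' →ₗ[k] M) (hinj : Injective emb) (hrange : LinearMap.range emb = Blk r)
    (Nr : Subgroup N) (hNr : ∀ s : N, s ∈ Nr ↔ act s r = r) (τ' : Representation k Nr E') (hemb : ∀ (s : Nr) (e : E'), emb (τ' s e) = τ (s : N) (emb e))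
    (q : E' →ₗ[k] Q) (hq : Surjective q) (hker : LinearMap.ker q = Coinvariants.ker τ')
    {ι : Type*} {TE : ι → E' →ₗ[k] E'} {TQ : ι → Q →ₗ[k] Q} {TM : ι → M →ₗ[k] M} {T : ι → Coinvariants τ →ₗ[k] Coinvariants τ}
    (hqT : ∀ i e, q (TE i e) = TQ i (q e)) (hembT : ∀ i e, emb (TE i e) = TM i (emb e)) (hmkT : ∀ i m, Coinvariants.mk τ (TM i m) = T i (Coinvariants.mk τ m))
    {χ : ι → k} {Eig : Submodule k Q} (hEig : ∀ v, v ∈ Eig ↔ ∀ i, TQ i v = χ i • v) {E : Submodule k (Coinvariants τ)} (hE : ∀ x, x ∈ E ↔ ∀ i, T i x = χ i • x) :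
    finrank k Eig = finrank k ↥((Blk r).map (Coinvariants.mk τ) ⊓ E) := by
  obtain ⟨ψ, hψinj, hψrange, hψ⟩ := exists_localModel_embedding h hact hact1 hperm rep tr htr hrep_act hrep_id hr emb hinj hrange Nr hNr τ' hemb q hq hker
  rw [← hψrange]
  exact LinearMap.finrank_eigen_eq_finrank_range_inf_eigen hEig hE ψ
    (fun i => comp_eq_comp_of_localModel (Coinvariants.mk τ) emb q hq ψ hψ (hqT i) (hembT i) (hmkT i)) hψinj

end Representation
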